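import Mathlib
import Summits.CriticalPhenomena.CardyFormulaZ2.Theorems.CardyMagicRigidityPositiveConeJointDefs
import Summits.CriticalPhenomena.CardyFormulaZ2.Theorems.CardyMagicRigidityNestingRigidityCriticalRadii
import HarnessLib

/-!
# Stub `treeRigidityTame_of_tameRigidity`, step (1b): typed cylinder probabilities from a.e. data to all data

Crux `Summit.CriticalPhenomena.CardyFormulaZ2.Theses.CardyMagicRigidity.NestingRigidity`
(stmt-CriticalPhenomena-4835), line `positive-cone-weight-doubling`, registered helper
`treeRigidityTame_of_tameRigidity : (tame rigidity) → TreeRigidityTame` (vocabulary of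
`Theorems/CardyMagicRigidityPositiveConeJointDefs.lean`, p130599).  The lattice inputs of the stub
(`TypedJointNestingLawAgreement`, and any convergence of lattice count laws to those of the limits) only
ever hold for Lebesgue-a.e. radii and windows, while the reconstruction step
(`cnLawEDist_eq_zero_of_typedCylinders_eq`, p131672) consumes the joint typed cylinder probabilities at
RATIONAL data.  This file bridges the two, sorry-free, using only INNER regularity of the pattern counts
(no criticality analysis is needed: a counted loop stays counted when the discs grow and the window shrinks
slightly, and the counted sets are finite):

* §1 `patternCount_eventually_eq_nhdsWithin` — for a locally finite configuration, positive radii and a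
  non-empty pattern, the pattern count is CONSTANT on a one-sided neighbourhood of the datum (bigger discs,
  smaller window: the filter `𝓝[upper-left orthant] (r₀, R₀)`); `typedCylinder_eventually_iff_nhdsWithin`
  — hence a joint typed cylinder event of finitely many two-disc families is eventually unchanged along
  that filter.
* §2 `tendsto_measure_typedCylinder_nhdsWithin` — for a presentation on `([0,1], Leb)` with a.e. locally
  finite values and measurable typed counts, the joint typed cylinder probabilities are continuous from
  the upper-left at every datum with positive radii (dominated convergence of indicators).
* §3 `frequently_nhdsWithin_orthant_of_ae` — a Lebesgue-a.e. set of data is visited FREQUENTLY by the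
  one-sided neighbourhood filter (its members contain boxes of positive volume).
* §4 `measure_typedCylinder_eq_of_ae_eq` (registered anchor) — two such presentations whose joint typed
  cylinder probabilities agree at a.e. positive datum agree at EVERY positive datum (limits along the
  restricted filter are unique).
-/

noncomputable section

open MeasureTheory Set Filter Metric
open scoped Real Topology BigOperators ENNReal

namespace Summit.CriticalPhenomena.CardyFormulaZ2.Cruxes.NestingRigidity.PositiveConeWeightDoubling

open Literature.Probability.RandomPlanarGeometry Literature.Probability.Percolation
  Literature.Probability.LatticeModels
open Summit.CriticalPhenomena.CardyFormulaZ2.Theses.CardyMagicRigidity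
open Summit.CriticalPhenomena.CardyFormulaZ2.Cruxes.NestingRigidity.RingCloudTomography

/-! ## §1 Inner regularity of the pattern counts -/

/-- **Pattern counts are locally constant from the upper-left.**  In a locally finite configuration, for
positive radii `r₀` and a non-empty pattern `S`, the pattern count at `(r, R)` equals the one at `(r₀, R₀)`
for all `(r, R)` close to `(r₀, R₀)` with `r ≥ r₀` (coordinatewise) and `R ≤ R₀`: the counted set can only
shrink (`patternLoops_mono`), and each of the finitely many loops counted at `(r₀, R₀)` is still counted
with a small margin (compact trace inside the open window; surrounded/avoided closed discs strictly below
the critical radius `dist(centre, trace)`, §2 of `…CriticalRadii`). -/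
theorem patternCount_eventually_eq_nhdsWithin {c : LoopConfig ℂ} (hc : c.IsLocallyFinite) {n : ℕ}
    (z : Fin n → ℂ) (r₀ : Fin n → ℝ) (R₀ : ℝ) (S : Finset (Fin n)) (hr₀ : ∀ i, 0 < r₀ i)
    (hS : S.Nonempty) :
    ∀ᶠ q in 𝓝[{q : (Fin n → ℝ) × ℝ | (∀ i, r₀ i ≤ q.1 i) ∧ q.2 ≤ R₀}] (r₀, R₀),
      patternCount c z q.1 q.2 S = patternCount c z r₀ R₀ S := by
  obtain ⟨i₀, hi₀⟩ := hS
  -- the counted set at `(r₀, R₀)`, finite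
  set A : Set (UnbasedLoop ℂ) := {u ∈ c.loops | u.range ⊆ ball (0 : ℂ) R₀ ∧
      (∀ i ∈ S, closedBall (z i) (r₀ i) ⊆ {w | u.wind w ≠ 0}) ∧
      ∀ i, i ∉ S → Disjoint (closedBall (z i) (r₀ i)) ({w | u.wind w ≠ 0} ∪ u.range)} with hA
  have hAfin : A.Finite := finite_patternLoops_of_isLocallyFinite hc z r₀ R₀ S hi₀ (hr₀ i₀)
  -- every counted loop is counted with a small margin
  have hev : ∀ᶠ η in 𝓝 (0 : ℝ), ∀ u ∈ A, u.range ⊆ ball (0 : ℂ) (R₀ - η) ∧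
      (∀ i ∈ S, closedBall (z i) (r₀ i + η) ⊆ {w | u.wind w ≠ 0}) ∧
      ∀ i, i ∉ S → Disjoint (closedBall (z i) (r₀ i + η)) ({w | u.wind w ≠ 0} ∪ u.range) := by
    refine hAfin.eventually_all.2 fun u hu ↦ ?_
    obtain ⟨-, hwin, hsur, havoid⟩ := hu
    have h1 : ∀ᶠ η in 𝓝 (0 : ℝ), u.range ⊆ ball (0 : ℂ) (R₀ - η) := by
      obtain ⟨R', hR', hsub⟩ := exists_lt_subset_ball u.isCompact_range.isClosed hwin
      filter_upwards [eventually_lt_nhds (sub_pos.2 hR')] with η hη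
      exact hsub.trans (ball_subset_ball (by linarith))
    have h2 : ∀ᶠ η in 𝓝 (0 : ℝ), ∀ i ∈ S, closedBall (z i) (r₀ i + η) ⊆ {w | u.wind w ≠ 0} := by
      refine Filter.eventually_all_finset S |>.2 fun i hi ↦ ?_
      have hd : r₀ i < infDist (z i) u.range :=
        lt_of_not_ge fun h ↦ not_closedBall_subset_of_infDist_le u h (hsur i hi)
      have hz : u.wind (z i) ≠ 0 := hsur i hi (mem_closedBall_self (hr₀ i).le)
      filter_upwards [eventually_lt_nhds (sub_pos.2 hd)] with η hη
      exact closedBall_subset_setOf_wind_ne_zero u hz (by linarith)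
    have h3 : ∀ᶠ η in 𝓝 (0 : ℝ), ∀ i, i ∉ S →
        Disjoint (closedBall (z i) (r₀ i + η)) ({w | u.wind w ≠ 0} ∪ u.range) := by
      refine eventually_all.2 fun i ↦ ?_
      by_cases hi : i ∈ S
      · exact Eventually.of_forall fun η h ↦ (h hi).elim
      · have hdis := havoid i hi
        have hd : r₀ i < infDist (z i) u.range :=
          lt_of_not_ge fun h ↦ not_disjoint_closedBall_of_infDist_le u h hdis
        have hz0 : u.wind (z i) = 0 := by
          by_contra h
          exact Set.disjoint_left.1 hdis (mem_closedBall_self (hr₀ i).le) (Or.inl h)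
        filter_upwards [eventually_lt_nhds (sub_pos.2 hd)] with η hη
        exact fun _ ↦ disjoint_closedBall_of_wind_eq_zero u hz0 (by linarith)
    filter_upwards [h1, h2, h3] with η a b c
    exact ⟨a, b, c⟩
  obtain ⟨η, hηP, hη⟩ := ((hev.filter_mono nhdsWithin_le_nhds).and
    (self_mem_nhdsWithin : Ioi (0 : ℝ) ∈ 𝓝[>] (0 : ℝ))).exists
  replace hη : 0 < η := hη
  -- on the `η`-ball of the orthant the counted set is exactly `A`
  have hball : ∀ᶠ q in 𝓝[{q : (Fin n → ℝ) × ℝ | (∀ i, r₀ i ≤ q.1 i) ∧ q.2 ≤ R₀}] (r₀, R₀),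
      dist q (r₀, R₀) < η :=
    eventually_nhdsWithin_of_eventually_nhds (Metric.eventually_nhds_iff_ball.2 ⟨η, hη, fun _ hq ↦ hq⟩)
  filter_upwards [hball, eventually_mem_nhdsWithin] with q hq hqO
  have hq' := hq
  rw [Prod.dist_eq, max_lt_iff] at hq'
  have hq1 : ∀ i, q.1 i ≤ r₀ i + η := fun i ↦ by
    have h1 : dist (q.1 i) (r₀ i) < η := (dist_le_pi_dist q.1 r₀ i).trans_lt hq'.1
    rw [Real.dist_eq, abs_lt] at h1
    linarith [h1.2]
  have hq2 : R₀ - η ≤ q.2 := by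
    have h1 : dist q.2 R₀ < η := hq'.2
    rw [Real.dist_eq, abs_lt] at h1
    linarith [h1.1]
  unfold patternCount
  congr 1
  refine (patternLoops_mono c z S hqO.1 hqO.2).antisymm fun u hu ↦ ?_
  obtain ⟨hw, hs, ha⟩ := hηP u hu
  exact ⟨hu.1, hw.trans (ball_subset_ball hq2),
    fun i hi ↦ (closedBall_subset_closedBall (hq1 i)).trans (hs i hi),
    fun i hi ↦ (ha i hi).mono_left (closedBall_subset_closedBall (hq1 i))⟩

/-- The single-type parts of a locally finite configuration are locally finite. -/
theorem isLocallyFinite_typeRestrict {c : LoopConfig ℂ} (hc : c.IsLocallyFinite) (t : Fin 2) :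
    (⟨fun j ↦ if j = t then c.F t else ∅⟩ : LoopConfig ℂ).IsLocallyFinite := by
  refine hc.mono fun j ↦ ?_
  change (if j = t then c.F t else ∅) ⊆ c.F j
  split_ifs with h
  · rw [h]
  · exact empty_subset _

/-- **Joint typed cylinder events are eventually unchanged from the upper-left.**  For a locally finite
configuration, finitely many two-disc families with positive radii `p₀.1 j i` and windows `p₀.2 j`, and
any table of values `k`, the event "all typed pattern counts at `p` equal `k`" coincides with the same
event at `p₀`, for all `p` near `p₀` with bigger discs and smaller windows. -/
theorem typedCylinder_eventually_iff_nhdsWithin {c : LoopConfig ℂ} (hc : c.IsLocallyFinite) {J : ℕ}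
    (x : Fin J → Fin 2 → ℂ) (p₀ : (Fin J → Fin 2 → ℝ) × (Fin J → ℝ)) (hp₀ : ∀ j i, 0 < p₀.1 j i)
    (k : Fin J → Fin 2 → Finset (Fin 2) → ℕ) :
    ∀ᶠ p in 𝓝[{p : (Fin J → Fin 2 → ℝ) × (Fin J → ℝ) | (∀ j i, p₀.1 j i ≤ p.1 j i) ∧
        ∀ j, p.2 j ≤ p₀.2 j}] p₀,
      (∀ j t, ∀ S : Finset (Fin 2), S.Nonempty →
        typedPatternCount c t (x j) (p.1 j) (p.2 j) S = k j t S) ↔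
      (∀ j t, ∀ S : Finset (Fin 2), S.Nonempty →
        typedPatternCount c t (x j) (p₀.1 j) (p₀.2 j) S = k j t S) := by
  set O : Set ((Fin J → Fin 2 → ℝ) × (Fin J → ℝ)) :=
    {p | (∀ j i, p₀.1 j i ≤ p.1 j i) ∧ ∀ j, p.2 j ≤ p₀.2 j} with hO
  -- per family, type and pattern: eventually equal counts (transport §1 along `p ↦ (p.1 j, p.2 j)`)
  have key : ∀ j t (S : Finset (Fin 2)), S.Nonempty → ∀ᶠ p in 𝓝[O] p₀,
      typedPatternCount c t (x j) (p.1 j) (p.2 j) S = typedPatternCount c t (x j) (p₀.1 j) (p₀.2 j) S := by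
    intro j t S hS
    have h1 := patternCount_eventually_eq_nhdsWithin (isLocallyFinite_typeRestrict hc t) (x j) (p₀.1 j)
      (p₀.2 j) S (hp₀ j) hS
    have hφ : Tendsto (fun p : (Fin J → Fin 2 → ℝ) × (Fin J → ℝ) ↦ (p.1 j, p.2 j)) (𝓝[O] p₀)
        (𝓝[{q : (Fin 2 → ℝ) × ℝ | (∀ i, p₀.1 j i ≤ q.1 i) ∧ q.2 ≤ p₀.2 j}] (p₀.1 j, p₀.2 j)) := by
      refine tendsto_nhdsWithin_of_tendsto_nhds_of_eventually_within _ ?_ ?_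
      · have hcont : Continuous fun p : (Fin J → Fin 2 → ℝ) × (Fin J → ℝ) ↦ (p.1 j, p.2 j) :=
          ((continuous_apply j).comp continuous_fst).prodMk ((continuous_apply j).comp continuous_snd)
        exact hcont.continuousAt.tendsto.mono_left nhdsWithin_le_nhds
      · filter_upwards [eventually_mem_nhdsWithin] with p hp
        exact ⟨fun i ↦ hp.1 j i, hp.2 j⟩
    exact hφ.eventually h1
  have hall : ∀ᶠ p in 𝓝[O] p₀, ∀ j t (S : Finset (Fin 2)), S.Nonempty →
      typedPatternCount c t (x j) (p.1 j) (p.2 j) S = typedPatternCount c t (x j) (p₀.1 j) (p₀.2 j) S := by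
    refine eventually_all.2 fun j ↦ eventually_all.2 fun t ↦ eventually_all.2 fun S ↦ ?_
    by_cases hS : S.Nonempty
    · filter_upwards [key j t S hS] with p hp
      exact fun _ ↦ hp
    · exact Eventually.of_forall fun p h ↦ (hS h).elim
  filter_upwards [hall] with p hp
  refine forall_congr' fun j ↦ forall_congr' fun t ↦ forall_congr' fun S ↦ forall_congr' fun hS ↦ ?_
  rw [hp j t S hS]

/-! ## §2 Continuity of the joint typed cylinder probabilities from the upper-left -/

/-- Joint typed cylinder events of a presentation with measurable typed counts are measurable. -/
theorem measurableSet_typedCylinder {Ω : Type*} [MeasurableSpace Ω] {X : Ω → LoopConfig ℂ}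
    (hm : ∀ (i : Fin 2) (n : ℕ) (x : Fin n → ℂ) (r : Fin n → ℝ) (R : ℝ) (S : Finset (Fin n)),
      Measurable fun s ↦ typedPatternCount (X s) i x r R S)
    {J : ℕ} (x : Fin J → Fin 2 → ℂ) (p : (Fin J → Fin 2 → ℝ) × (Fin J → ℝ))
    (k : Fin J → Fin 2 → Finset (Fin 2) → ℕ) :
    MeasurableSet {s | ∀ j t, ∀ S : Finset (Fin 2), S.Nonempty →
      typedPatternCount (X s) t (x j) (p.1 j) (p.2 j) S = k j t S} := by
  have : {s | ∀ j t, ∀ S : Finset (Fin 2), S.Nonempty →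
      typedPatternCount (X s) t (x j) (p.1 j) (p.2 j) S = k j t S} =
      ⋂ j, ⋂ t, ⋂ S : Finset (Fin 2), {s | S.Nonempty →
        typedPatternCount (X s) t (x j) (p.1 j) (p.2 j) S = k j t S} := by
    ext s
    simp only [mem_setOf_eq, mem_iInter]
  rw [this]
  refine MeasurableSet.iInter fun j ↦ MeasurableSet.iInter fun t ↦ MeasurableSet.iInter fun S ↦ ?_
  by_cases hS : S.Nonempty
  · simp only [hS, forall_true_left]
    exact measurableSet_eq_fun (hm t 2 _ _ _ S) measurable_const
  · simp only [hS, IsEmpty.forall_iff, setOf_true, MeasurableSet.univ]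

/-- **Joint typed cylinder probabilities are continuous from the upper-left** at every datum with
positive radii, for a presentation on `([0,1], Leb)` with a.e. locally finite values and measurable typed
counts (dominated convergence of the indicators, which are eventually constant pathwise by §1). -/
theorem tendsto_measure_typedCylinder_nhdsWithin {X : unitInterval → LoopConfig ℂ}
    (hX : ∀ᵐ s : unitInterval, (X s).IsLocallyFinite)
    (hm : ∀ (i : Fin 2) (n : ℕ) (x : Fin n → ℂ) (r : Fin n → ℝ) (R : ℝ) (S : Finset (Fin n)),
      Measurable fun s ↦ typedPatternCount (X s) i x r R S)
    {J : ℕ} (x : Fin J → Fin 2 → ℂ) (p₀ : (Fin J → Fin 2 → ℝ) × (Fin J → ℝ)) (hp₀ : ∀ j i, 0 < p₀.1 j i)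
    (k : Fin J → Fin 2 → Finset (Fin 2) → ℕ) :
    Tendsto (fun p : (Fin J → Fin 2 → ℝ) × (Fin J → ℝ) ↦ volume {s : unitInterval | ∀ j t,
        ∀ S : Finset (Fin 2), S.Nonempty → typedPatternCount (X s) t (x j) (p.1 j) (p.2 j) S = k j t S})
      (𝓝[{p : (Fin J → Fin 2 → ℝ) × (Fin J → ℝ) | (∀ j i, p₀.1 j i ≤ p.1 j i) ∧ ∀ j, p.2 j ≤ p₀.2 j}] p₀)
      (𝓝 (volume {s : unitInterval | ∀ j t, ∀ S : Finset (Fin 2), S.Nonempty →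
        typedPatternCount (X s) t (x j) (p₀.1 j) (p₀.2 j) S = k j t S})) := by
  refine tendsto_measure_of_ae_tendsto_indicator_of_isFiniteMeasure _
    (measurableSet_typedCylinder hm x p₀ k) (fun p ↦ measurableSet_typedCylinder hm x p k) ?_
  filter_upwards [hX] with s hs
  exact typedCylinder_eventually_iff_nhdsWithin hs x p₀ hp₀ k

/-! ## §3 Lebesgue-a.e. sets of data are visited frequently from the upper-left -/

/-- **An a.e. set of data is frequently visited by the one-sided neighbourhood filter**: every member of
`𝓝[upper-left orthant] p₀` contains a box of positive Lebesgue measure, so it meets every set of full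
measure. -/
theorem frequently_nhdsWithin_orthant_of_ae {J : ℕ} (p₀ : (Fin J → Fin 2 → ℝ) × (Fin J → ℝ))
    {G : (Fin J → Fin 2 → ℝ) × (Fin J → ℝ) → Prop}
    (hG : ∀ᵐ p : (Fin J → Fin 2 → ℝ) × (Fin J → ℝ), G p) :
    ∃ᶠ p in 𝓝[{p : (Fin J → Fin 2 → ℝ) × (Fin J → ℝ) | (∀ j i, p₀.1 j i ≤ p.1 j i) ∧
      ∀ j, p.2 j ≤ p₀.2 j}] p₀, G p := by
  rw [Filter.frequently_iff]
  intro U hU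
  obtain ⟨ε, hε, hU'⟩ := Metric.mem_nhdsWithin_iff.1 hU
  -- a box inside `ball p₀ ε ∩ orthant`
  set Bx : Set ((Fin J → Fin 2 → ℝ) × (Fin J → ℝ)) :=
    (Set.pi univ fun j ↦ Set.pi univ fun i ↦ Ioo (p₀.1 j i) (p₀.1 j i + ε / 2)) ×ˢ
      (Set.pi univ fun j ↦ Ioo (p₀.2 j - ε / 2) (p₀.2 j)) with hBx
  have hsub : Bx ⊆ U := by
    intro p hp
    simp only [hBx, mem_prod, Set.mem_univ_pi, mem_Ioo] at hp
    refine hU' ⟨?_, fun j i ↦ (hp.1 j i).1.le, fun j ↦ (hp.2 j).2.le⟩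
    rw [mem_ball, Prod.dist_eq, max_lt_iff]
    constructor
    · refine (dist_pi_lt_iff hε).2 fun j ↦ (dist_pi_lt_iff hε).2 fun i ↦ ?_
      rw [Real.dist_eq, abs_lt]
      constructor <;> linarith [(hp.1 j i).1, (hp.1 j i).2]
    · refine (dist_pi_lt_iff hε).2 fun j ↦ ?_
      rw [Real.dist_eq, abs_lt]
      constructor <;> linarith [(hp.2 j).1, (hp.2 j).2]
  have hpos : volume Bx ≠ 0 := by
    rw [hBx, Measure.volume_eq_prod, Measure.prod_prod, volume_pi_pi, volume_pi_pi]
    simp only [volume_pi_pi, Real.volume_Ioo]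
    have h2 : ENNReal.ofReal (ε / 2) ≠ 0 := by
      rw [Ne, ENNReal.ofReal_eq_zero, not_le]
      positivity
    refine mul_ne_zero (Finset.prod_ne_zero_iff.2 fun j _ ↦ Finset.prod_ne_zero_iff.2 fun i _ ↦ ?_)
      (Finset.prod_ne_zero_iff.2 fun j _ ↦ ?_)
    · rwa [show p₀.1 j i + ε / 2 - p₀.1 j i = ε / 2 by ring]
    · rwa [show p₀.2 j - (p₀.2 j - ε / 2) = ε / 2 by ring]
  by_contra hcon
  push Not at hcon
  exact hpos (measure_mono_null (fun p hp ↦ hcon p (hsub hp)) (ae_iff.1 hG))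

/-! ## §4 From a.e. data to all data (registered anchor) -/

/-- **Joint typed cylinder probabilities that agree at a.e. positive datum agree at every positive datum
(registered anchor).**  Let `X, X'` be presentations on `([0,1], Leb)` with a.e. locally finite values and
measurable typed pattern counts.  Fix finitely many two-disc families (centres `x j`) and a table of values
`k`.  If the joint typed cylinder probabilities `Leb{s | ∀ j t S ≠ ∅, N^{(t)}_S(X s; x j, p.1 j, p.2 j) =
k j t S}` of `X` and `X'` agree for Lebesgue-a.e. datum `p = (radii, windows)` with positive entries, they
agree at EVERY datum `p₀` with positive entries: both are limits from the upper-left (§2) and the a.e. set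
is visited frequently by that filter (§3), so the limits coincide. -/
theorem measure_typedCylinder_eq_of_ae_eq : ∀ {X X' : unitInterval → LoopConfig ℂ},
    (∀ᵐ s : unitInterval, (X s).IsLocallyFinite) → (∀ᵐ s : unitInterval, (X' s).IsLocallyFinite) →
    (∀ (i : Fin 2) (n : ℕ) (x : Fin n → ℂ) (r : Fin n → ℝ) (R : ℝ) (S : Finset (Fin n)),
      Measurable (fun s ↦ typedPatternCount (X s) i x r R S) ∧
      Measurable (fun s ↦ typedPatternCount (X' s) i x r R S)) →
    ∀ {J : ℕ} (x : Fin J → Fin 2 → ℂ) (k : Fin J → Fin 2 → Finset (Fin 2) → ℕ),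
    (∀ᵐ p : (Fin J → Fin 2 → ℝ) × (Fin J → ℝ), (∀ j i, 0 < p.1 j i) → (∀ j, 0 < p.2 j) →
      volume {s : unitInterval | ∀ j t, ∀ S : Finset (Fin 2), S.Nonempty →
        typedPatternCount (X s) t (x j) (p.1 j) (p.2 j) S = k j t S} =
      volume {s : unitInterval | ∀ j t, ∀ S : Finset (Fin 2), S.Nonempty →
        typedPatternCount (X' s) t (x j) (p.1 j) (p.2 j) S = k j t S}) →
    ∀ (p₀ : (Fin J → Fin 2 → ℝ) × (Fin J → ℝ)), (∀ j i, 0 < p₀.1 j i) → (∀ j, 0 < p₀.2 j) →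
      volume {s : unitInterval | ∀ j t, ∀ S : Finset (Fin 2), S.Nonempty →
        typedPatternCount (X s) t (x j) (p₀.1 j) (p₀.2 j) S = k j t S} =
      volume {s : unitInterval | ∀ j t, ∀ S : Finset (Fin 2), S.Nonempty →
        typedPatternCount (X' s) t (x j) (p₀.1 j) (p₀.2 j) S = k j t S} := by
  intro X X' hX hX' hmeas J x k h p₀ hp₀ hp₀'
  have hf := tendsto_measure_typedCylinder_nhdsWithin hX (fun i n x r R S ↦ (hmeas i n x r R S).1) x p₀
    hp₀ k
  have hg := tendsto_measure_typedCylinder_nhdsWithin hX' (fun i n x r R S ↦ (hmeas i n x r R S).2) x p₀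
    hp₀ k
  set O : Set ((Fin J → Fin 2 → ℝ) × (Fin J → ℝ)) :=
    {p | (∀ j i, p₀.1 j i ≤ p.1 j i) ∧ ∀ j, p.2 j ≤ p₀.2 j} with hO
  -- positivity of the data holds eventually along `𝓝[O] p₀`
  have hposev : ∀ᶠ p in 𝓝[O] p₀, (∀ j i, 0 < p.1 j i) ∧ ∀ j, 0 < p.2 j := by
    refine (eventually_mem_nhdsWithin.mono fun p hp ↦ fun j i ↦ (hp₀ j i).trans_le (hp.1 j i)).and ?_
    refine eventually_all.2 fun j ↦ ?_
    have hc : Tendsto (fun p : (Fin J → Fin 2 → ℝ) × (Fin J → ℝ) ↦ p.2 j) (𝓝[O] p₀) (𝓝 (p₀.2 j)) :=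
      ((continuous_apply j).comp continuous_snd).continuousAt.tendsto.mono_left nhdsWithin_le_nhds
    exact hc.eventually (eventually_gt_nhds (hp₀' j))
  -- the a.e. set of agreement is visited frequently
  have hfreq : ∃ᶠ p in 𝓝[O] p₀,
      volume {s : unitInterval | ∀ j t, ∀ S : Finset (Fin 2), S.Nonempty →
        typedPatternCount (X s) t (x j) (p.1 j) (p.2 j) S = k j t S} =
      volume {s : unitInterval | ∀ j t, ∀ S : Finset (Fin 2), S.Nonempty →
        typedPatternCount (X' s) t (x j) (p.1 j) (p.2 j) S = k j t S} :=
    ((frequently_nhdsWithin_orthant_of_ae p₀ h).and_eventually hposev).mono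
      fun p hp ↦ hp.1 hp.2.1 hp.2.2
  exact tendsto_nhds_unique_of_frequently_eq hf hg hfreq

end Summit.CriticalPhenomena.CardyFormulaZ2.Cruxes.NestingRigidity.PositiveConeWeightDoubling

end
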